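import Mathlib
import HarnessLib

/-!
# (H3) of (K-wild-hom), step 1: the PER-SLOT NAKAYAMA EXTRACTION — a generator `u` of `J = (u) + J′` can be replaced by `c·h`, `h` from any
# generating set of `J`, up to `J′`

Route `ResolutionOfSingularities/WeightedInvariant`, door crux `HypersurfaceCentreConstruction` (stmt-ResolutionOfSingularities-19897), P3 rung;
ORDER (o50) of res-L1-w43-plan-1, kernel item (H3) `exists_homogeneous_sigmaMaximiser` (memo `plan/tools/res-type-060/o50/K-WILD-HOM.md` §2/§6),
first step; res-type-060 (gen 10).  [OURS · L1 W4.3 · helper, counted 0] — local algebra over Mathlib only; nothing here is a statement of the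
manuscript under review.  AI proof, weaker than expert review.

* `KWildHom.exists_unit_mul_sub_mem_of_span_eq` — in a local ring, if `J = (u) ⊔ J′`, `u ∉ J′ ⊔ 𝔪·J`, and `J = Ideal.span H`, then some `h ∈ H` and
  some unit `c` have `u − c·h ∈ J′` (and then `h − c⁻¹·u ∈ J′`).  USE (memo §2): `J = J_{w_l}(u)` the weighted monomial piece, `J′` the piece of
  the monomials avoiding the slot `u_l`, `H` = images of the HOMOGENEOUS generators supplied by `hJhom`; the slot `u_l` is then replaced by the
  homogeneous `h` without changing the weighted filtration (jets lemma `weightedMonomialIdeal_eq_of_forall_sub_mem`) — remaining steps of (H3).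
-/

set_option linter.dupNamespace false -- mandated namespace of this single-conjunct summit

namespace Summit.ResolutionOfSingularities.ResolutionOfSingularities.Theorems

namespace KWildHom

open IsLocalRing

variable {R : Type*} [CommRing R] [IsLocalRing R]

/-- **PER-SLOT NAKAYAMA EXTRACTION.**  In a local ring: `J = (u) ⊔ J′`, `u ∉ J′ ⊔ 𝔪·J`, `J = span H` ⇒ `∃ h ∈ H, ∃ c` unit, `u − c·h ∈ J′`.
[OURS · L1 W4.3] -/
theorem exists_unit_mul_sub_mem_of_span_eq {J J' : Ideal R} {u : R} (hJ : J = Ideal.span {u} ⊔ J')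
    (hu : u ∉ J' ⊔ maximalIdeal R * J) {H : Set R} (hH : Ideal.span H = J) :
    ∃ h ∈ H, ∃ c : R, IsUnit c ∧ u - c * h ∈ J' := by
  -- some generator escapes `N = J′ ⊔ 𝔪J`
  have hex : ∃ h ∈ H, h ∉ J' ⊔ maximalIdeal R * J := by
    by_contra hall
    push Not at hall
    apply hu
    have hle : J ≤ J' ⊔ maximalIdeal R * J := by
      conv_lhs => rw [← hH]
      exact Ideal.span_le.mpr hall
    have huJ : u ∈ J := by rw [hJ]; exact Ideal.mem_sup_left (Ideal.mem_span_singleton_self u)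
    exact hle huJ
  obtain ⟨h, hhH, hhN⟩ := hex
  -- write `h = r·u + j′`
  have hhJ : h ∈ J := by rw [← hH]; exact Ideal.subset_span hhH
  rw [hJ] at hhJ
  obtain ⟨a, ha, j', hj', hsum⟩ := Submodule.mem_sup.mp hhJ
  obtain ⟨r, rfl⟩ := Ideal.mem_span_singleton'.mp ha
  -- `r` is a unit, else `h ∈ N`
  have hr : IsUnit r := by
    by_contra hr
    apply hhN
    rw [← hsum, add_comm]
    refine Submodule.add_mem_sup hj' ?_
    have hrm : r ∈ maximalIdeal R := (IsLocalRing.mem_maximalIdeal _).mpr hr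
    have huJ : u ∈ J := by rw [hJ]; exact Ideal.mem_sup_left (Ideal.mem_span_singleton_self u)
    exact Ideal.mul_mem_mul hrm huJ
  obtain ⟨c, hc⟩ := hr.exists_left_inv
  refine ⟨h, hhH, c, IsUnit.of_mul_eq_one _ hc, ?_⟩
  have : u - c * h = -(c * j') := by
    rw [← hsum, mul_add, ← mul_assoc, hc, one_mul]; ring
  rw [this]
  exact J'.neg_mem (Ideal.mul_mem_left _ _ hj')

omit [IsLocalRing R] in
/-- … and then symmetrically `h − c′·u ∈ J′` for the inverse unit. [folklore] -/
theorem exists_unit_mul_sub_mem_symm {J' : Ideal R} {u h c : R} (hc : IsUnit c) (hmem : u - c * h ∈ J') :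
    ∃ c' : R, IsUnit c' ∧ h - c' * u ∈ J' := by
  obtain ⟨d, hd⟩ := hc.exists_left_inv
  refine ⟨d, IsUnit.of_mul_eq_one _ hd, ?_⟩
  have : h - d * u = -(d * (u - c * h)) := by
    rw [mul_sub, ← mul_assoc, hd, one_mul]; ring
  rw [this]
  exact J'.neg_mem (Ideal.mul_mem_left _ _ hmem)

end KWildHom

end Summit.ResolutionOfSingularities.ResolutionOfSingularities.Theorems
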